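import Mathlib.FieldTheory.Normal.Closure
import Mathlib.FieldTheory.PrimitiveElement
import Mathlib.FieldTheory.Extension
import HarnessLib

/-!
# The normal closure of a stem field is the splitting field of the minimal polynomial

Topic `FieldTheory/Galois`; theorems only, Mathlib-only imports. For a field extension `L/F` in which the relevant minimal polynomials split
(e.g. `L/F` normal, or `L` algebraically closed) Mathlib defines `normalClosure F K L = ⨆ f : K →ₐ[F] L, f.fieldRange` and proves
`normalClosure_eq_iSup_adjoin : normalClosure F K L = ⨆ x : K, adjoin F ((minpoly F x).rootSet L)`. The statements below are the ONE-GENERATOR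
forms (the «stem field» `K = F(e)` of an irreducible polynomial `p = minpoly F e`):

* `normalClosure_eq_adjoin_rootSet_minpoly_of_adjoin_eq_top` — if `F⟮e⟯ = ⊤` in `K` and every `minpoly F x` (`x ∈ K`) splits in `L`, then
  **`normalClosure F K L = adjoin F ((minpoly F e).rootSet L)`**: the normal closure of the stem field is the splitting field (inside `L`) of `p`.
* `adjoin_rootSet_minpoly_eq_normalClosure_adjoin_simple` — for `x ∈ L` with `L/F` normal: `adjoin F ((minpoly F x).rootSet L) =
  normalClosure F F⟮x⟯ L`; hence `adjoin_rootSet_minpoly_eq_of_adjoin_simple_eq`: `F⟮x⟯ = F⟮y⟯ ⟹` the two root fields coincide.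
* `normalClosure_eq_of_algEquiv` — `normalClosure F K L = normalClosure F K' L` for `K ≃ₐ[F] K'` (the closure is an invariant of the
  isomorphism class of the abstract extension).

Used by cell bsd-f1-sign2 (`Summits/…/AlignedTransportAtTwo…SharedCubicDivisionField`: the `2`-division field of an elliptic curve is the normal
closure of the cubic field of a `2`-torsion abscissa). Deliberately NOT here: degrees (see `NormalClosureDegree.lean`), Galois groups.

References: [MilneFT2022] Ch. 2 (stem fields `F[x]/(p)`), Ch. 3 (splitting fields; the splitting field of `p` is generated by the conjugates of
one root), Ch. 5 (normal closure); standard.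
-/

namespace Literature.FieldTheory.Galois

open IntermediateField Module Polynomial

variable {F K L : Type*} [Field F] [Field K] [Field L] [Algebra F K] [Algebra F L]

/-! ## 1. Invariance under isomorphism of the abstract extension -/

/-- **The normal closure depends only on the isomorphism class of `K/F`**: for `φ : K ≃ₐ[F] K'`,
`normalClosure F K L = normalClosure F K' L` (the embeddings `K' →ₐ[F] L` are the `f ∘ φ⁻¹`). [cite: MilneFT2022, Ch. 5 (normal closure)] -/
theorem normalClosure_eq_of_algEquiv {K' : Type*} [Field K'] [Algebra F K'] (φ : K ≃ₐ[F] K') :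
    normalClosure F K L = normalClosure F K' L := by
  refine le_antisymm (normalClosure_le_iff.mpr fun f ↦ ?_) (normalClosure_le_iff.mpr fun g ↦ ?_)
  · rintro _ ⟨x, rfl⟩
    exact AlgHom.fieldRange_le_normalClosure (f.comp (φ.symm : K' →ₐ[F] K)) ⟨φ x, by simp⟩
  · rintro _ ⟨x', rfl⟩
    exact AlgHom.fieldRange_le_normalClosure (g.comp (φ : K →ₐ[F] K')) ⟨φ.symm x', by simp⟩

/-! ## 2. One generator: the normal closure of a stem field is the root field of the minimal polynomial -/

/-- **Normal closure of a stem field.** Let `e ∈ K` generate `K/F` (`F⟮e⟯ = ⊤`), `K/F` algebraic, and suppose every minimal polynomial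
`minpoly F x` (`x ∈ K`) splits in `L` (e.g. `L/F` normal containing a copy of `K`, or `L` algebraically closed). Then
**`normalClosure F K L = adjoin F ((minpoly F e).rootSet L)`** — the compositum of the conjugates `f(K) = F(f e)` is generated by the
conjugates `f e` of `e`, which are exactly the roots of `minpoly F e` in `L`. [cite: MilneFT2022, Ch. 3 (splitting fields) and Ch. 5 (normal closure)] -/
theorem normalClosure_eq_adjoin_rootSet_minpoly_of_adjoin_eq_top [Algebra.IsAlgebraic F K] {e : K} (he : F⟮e⟯ = ⊤)
    (hsplits : ∀ x : K, ((minpoly F x).map (algebraMap F L)).Splits) :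
    normalClosure F K L = adjoin F ((minpoly F e).rootSet L) := by
  have hrange := Algebra.IsAlgebraic.range_eval_eq_rootSet_minpoly_of_splits L hsplits e
  refine le_antisymm (normalClosure_le_iff.mpr fun f ↦ ?_) (adjoin_le_iff.mpr fun r hr ↦ ?_)
  · rw [AlgHom.fieldRange_eq_map, ← he, adjoin_map, Set.image_singleton, adjoin_simple_le_iff]
    exact subset_adjoin F _ (hrange ▸ Set.mem_range_self f)
  · obtain ⟨f, hf⟩ := (hrange.symm ▸ hr : r ∈ Set.range fun ψ : K →ₐ[F] L ↦ ψ e)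
    exact AlgHom.fieldRange_le_normalClosure f ⟨e, hf⟩

/-- The same over an algebraically closed `L` (no splitting hypothesis). [cite: MilneFT2022, Ch. 3 (splitting fields) and Ch. 5 (normal closure)] -/
theorem normalClosure_eq_adjoin_rootSet_minpoly_of_adjoin_eq_top_of_isAlgClosed [Algebra.IsAlgebraic F K] [IsAlgClosed L] {e : K}
    (he : F⟮e⟯ = ⊤) : normalClosure F K L = adjoin F ((minpoly F e).rootSet L) :=
  normalClosure_eq_adjoin_rootSet_minpoly_of_adjoin_eq_top he fun _ ↦ IsAlgClosed.splits _

/-- **A finite extension of degree `deg (minpoly F e)` is the stem field of `e`** (`F⟮e⟯ = ⊤`), the hypothesis of the previous theorems in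
the form met in practice (e.g. a cubic number field containing a root of an irreducible cubic). [cite: MilneFT2022, Ch. 2 (stem fields)] -/
theorem adjoin_simple_eq_top_of_natDegree_minpoly_eq_finrank [FiniteDimensional F K] {e : K}
    (h : (minpoly F e).natDegree = finrank F K) : F⟮e⟯ = ⊤ :=
  (Field.primitive_element_iff_minpoly_natDegree_eq F e).mpr h

/-! ## 3. Elements of a normal extension: the root field of `minpoly F x` is the normal closure of `F⟮x⟯` -/

/-- For `x ∈ L`, `L/F` normal: **`adjoin F ((minpoly F x).rootSet L) = normalClosure F F⟮x⟯ L`** (`= ⨆_{σ ∈ Gal(L/F)} σ F⟮x⟯`,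
Mathlib `normalClosure_def''`). [cite: MilneFT2022, Ch. 3 (splitting fields) and Ch. 5 (normal closure)] -/
theorem adjoin_rootSet_minpoly_eq_normalClosure_adjoin_simple [Normal F L] (x : L) :
    adjoin F ((minpoly F x).rootSet L) = normalClosure F F⟮x⟯ L := by
  have hgen : F⟮AdjoinSimple.gen F x⟯ = ⊤ :=
    lift_injective _ (by rw [lift_adjoin_simple, lift_top, AdjoinSimple.coe_gen])
  have hsplits : ∀ y : F⟮x⟯, ((minpoly F y).map (algebraMap F L)).Splits := fun y ↦ by
    rw [← minpoly.algebraMap_eq (algebraMap F⟮x⟯ L).injective y]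
    exact Normal.splits inferInstance _
  rw [normalClosure_eq_adjoin_rootSet_minpoly_of_adjoin_eq_top hgen hsplits, minpoly_gen]

/-- Hence **`F⟮x⟯ = F⟮y⟯ ⟹ adjoin F (rootSet (minpoly F x)) = adjoin F (rootSet (minpoly F y))`** in a normal `L/F`: the root field of the
minimal polynomial is an invariant of the simple subextension, not of the generator. [cite: MilneFT2022, Ch. 5 (normal closure)] -/
theorem adjoin_rootSet_minpoly_eq_of_adjoin_simple_eq [Normal F L] {x y : L} (h : F⟮x⟯ = F⟮y⟯) :
    adjoin F ((minpoly F x).rootSet L) = adjoin F ((minpoly F y).rootSet L) := by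
  rw [adjoin_rootSet_minpoly_eq_normalClosure_adjoin_simple, adjoin_rootSet_minpoly_eq_normalClosure_adjoin_simple,
    normalClosure_eq_of_algEquiv (equivOfEq h)]

end Literature.FieldTheory.Galois
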